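import Summits.BirchSwinnertonDyer.BirchSwinnertonDyer.Theorems.SignedLowerHalvesSprungLowerDivisibilityAtThreeRankCut
import Summits.BirchSwinnertonDyer.BirchSwinnertonDyer.Theses.SignedLowerHalves
import Summits.BirchSwinnertonDyer.BirchSwinnertonDyer.Theorems.SignedLowerHalvesSprungLowerHalfAtThreeKDotSplitReal
import Summits.BirchSwinnertonDyer.BirchSwinnertonDyer.Theorems.SprungSharpFlatMainConjecture
import Literature.NumberTheory.EllipticCurves.Sprung2012.SharpFlatKatoDivisibility
import Literature.NumberTheory.EllipticCurves.CyclotomicZpExtensionLocalGeneratorProofs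
import Literature.NumberTheory.EllipticCurves.Sprung2017.SharpFlatNonvanishingProofs
import Literature.NumberTheory.EllipticCurves.Sprung2017.SharpFlatPAdicLFunctionProofs
import Literature.NumberTheory.EllipticCurves.Sprung2024.ChromaticCharValueRankZeroAllN
import Literature.NumberTheory.EllipticCurves.ModularCurve
import Literature.NumberTheory.EllipticCurves.ModularCurveNeronLatticeProofs
import Literature.NumberTheory.EllipticCurves.ModularParametrizationDegreeHoldsProofs
import Literature.NumberTheory.EllipticCurves.ModularCurveManinSemistableLatticeFormProofs
import Literature.NumberTheory.EllipticCurves.LeadingTermPPartProofs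
import HarnessLib

/-!
# Route `SignedLowerHalves`, crux 5 `SprungLowerHalfAtThree` (item 19003) and its child K1 `SprungLowerDivisibilityAtThree`
# (item stmt-BirchSwinnertonDyer-19875): THE RANK-ZERO GLUE — crux 5 consumes K1 only at analytic rank ZERO, so the `(T)`-clause
# of stub S4b at `r_an ≥ 2`, Gross–Zagier–Kolyvagin and the Kobayashi–Sprung simple-zero fact are idle in crux 5's cone

Cell `bsd-ssimc` (host), width seat `cruxlead-stmt-BirchSwinnertonDyer-19875-w2` (g3) under the 19875 lead; `--supports` 19875
`--as helper`; theorems only; closes NO item (crux 5 is SPLIT, its glue item 19880 is closed; K1 stays open); registry unchanged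
(skeleton v7 of record for K1: K_spor `stub_katoFineLowerSporadic`, S4b `stub_cyclotomicLowerRest`, S5 `stub_heldInputs`);
CALIBRATION in the sense of the pen's word R-RANKCUT (D34-4): no item is restated. Companion (route-independent) file
`…SprungLowerDivisibilityAtThreeRankCut.lean` (the per-pair rank cut). Crux 5, K1, BSD and leaf X8 are NOT proved by anything here.

## What is proved

Notation as in the companion: `hKsp` = the registered stub K_spor VERBATIM (Kato 2004 Conj. 12.10, Eisenstein half, at the sporadic
common zeros); `hCyc` = the positive-level part of S4b VERBATIM (the lead's p617801: Sprung 2012 Main Conj. 7.21's Eisenstein inequality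
at the cyclotomic common zeros `(Φ_{3^j}(1+T))`, `j ≥ 1`). Status quo in the kernel: `crux 5 ⟸ K1 ∧ K2 ∧ K3 ∧ S4` (glue 19880),
`K1 ⟸ hKsp ∧ S4b ∧ (h714 ∧ h3 ∧ hJ ∧ hGZK ∧ hKob)` (p614828), `S4b ⟸ hCyc ∧ hMinOrd` (p617801).

* §1 `sprungLowerHalfAtThree_of_lowerDivisibility_analyticRank_eq_zero` — **crux 5 `SprungLowerHalfAtThree` BY NAME from «K1 at the
  X8 pairs with `r_an = 0`» ∧ K2 `SharpFlatRankZeroConverseAtThree` ∧ K3 `SharpFlatCharValueRankZeroAllLevels` ∧ S4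
  `SharpFlatPublishedInputsAtThree`**: a re-run of the landed glue `SprungLowerHalfAtThreeSplit.sprungLowerHalfAtThreeGlue_holds`
  (item 19880), which invokes K1 ONLY when `Sel_{3^∞}(E/ℚ)` is finite — positive corank gives the datum `ξ = h = 0`
  (`chromaticDatum_of_not_finite_selmer`) — and then, by K2, `L(E,1) ≠ 0`, i.e. `r_an = 0`
  (`analyticRank_eq_zero_of_entireLFunction_one_ne_zero`, unconditional: the order of vanishing of a germ with non-zero value is `0`).
* §2 `sprungLowerHalfAtThree_of_katoSporadic_of_posLevel` — the composition with the companion's §3: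
  **crux 5 ⟸ hKsp ∧ hCyc ∧ h714 ∧ h3 ∧ hJ ∧ K2 ∧ K3 ∧ S4** (`h714` = Sprung 2012 Thm. 7.14 is the global form of S4's clause (T)).
  The rank cut removes `hMinOrd` (the signed `3`-adic BSD rank inequality at `r_an ≥ 2`), `hGZK` and `hKob` from crux 5's cone: what
  remains OPEN for route K3 behind item 19875 is exactly «Kato 12.10 at the sporadic common zeros ∧ Sprung 7.21 at the positive-level
  cyclotomic common zeros» AT THE X8 PAIRS OF ANALYTIC RANK ZERO (both OPEN IN PRINT at `(3, a₃ = ±3)` class-wide).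

References: [Sprung2012] Thm. 2.2 (p. 1487), Thm. 1.2/7.14 (p. 1504), Prop. 6.14 (p. 1498), Main Conj. 7.21 (p. 1505); [Sprung2024] §5.2
Lemmas 5.5–5.9; [Kato2004Asterisque] Conj. 12.10 (p. 224); [BirchSwinnertonDyer1965] (order of vanishing); tree:
`…SprungLowerHalfAtThreeSplit` (item 19880), `…SprungLowerDivisibilityAtThreeRankCut` (companion), `…KatoFineSporadic` (p614828),
`…CyclotomicLowerRestSplit` (p617801).
-/

set_option linter.dupNamespace false
set_option autoImplicit false

noncomputable section

open scoped Classical NumberField MatrixGroups ModularForm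

open NumberField IsDedekindDomain CongruenceSubgroup WeierstrassCurve Field
  Literature.NumberTheory.EllipticCurves Literature.NumberTheory.EllipticCurves.ModularForms
  Literature.NumberTheory.EllipticCurves.ZpExtension Literature.NumberTheory.EllipticCurves.Sprung2017
  Literature.NumberTheory.EllipticCurves.Sprung2012 Literature.NumberTheory.EllipticCurves.Rank1Residual
  Literature.NumberTheory.EllipticCurves.IwasawaAlgebra Literature.NumberTheory.EllipticCurves.Kato2004
  Literature.NumberTheory.EllipticCurves.Module
  Summit.BirchSwinnertonDyer.BirchSwinnertonDyer.Theorems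
  Summit.BirchSwinnertonDyer.BirchSwinnertonDyer.Theorems.SmallImageSignedMuDefect
  Summit.BirchSwinnertonDyer.Rank1Residual.Supersingular
  Summit.BirchSwinnertonDyer.BirchSwinnertonDyer.Theses.SignedLowerHalves

namespace Summit.BirchSwinnertonDyer.BirchSwinnertonDyer.Theorems.ChromaticCommonZeros

/-! ### §1 Crux 5 `SprungLowerHalfAtThree` consumes K1 only at analytic rank zero -/

/-- **Crux 5 `SprungLowerHalfAtThree` (route `SignedLowerHalves`, item 19003) BY NAME from «K1 at the X8 pairs of analytic rank
`0`» and the split's other children K2 `SharpFlatRankZeroConverseAtThree`, K3 `SharpFlatCharValueRankZeroAllLevels`, S4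
`SharpFlatPublishedInputsAtThree`.** Verbatim the landed glue `SprungLowerHalfAtThreeGlue_holds` (item 19880, seat k3c5-kdot-split g4):
S4(M) gives a newform and the real `(f, ϖ, L♯, L♭)` (`stub_sprungPair_of_isNewformOf`); if `Sel_{3^∞}(E/ℚ)` is infinite the datum is
`ξ = h = 0` (`chromaticDatum_of_not_finite_selmer`) and K1 is NOT used; otherwise K2 gives `L(E,1) ≠ 0`, hence `r_an = 0`
(`analyticRank_eq_zero_of_entireLFunction_one_ne_zero`, unconditional), and K1 is used at THAT pair only (a colour with `L^• ≠ 0`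
by Prop. 6.14, the real dual datum, cotorsion from S4(T), Kim's unit from K3). So route K3 needs item 19875 at `r_an = 0` only.
Pure glue; CONDITIONAL on its four displayed hypotheses; closes nothing (calibration). [cite: Sprung2012, Thm. 2.2, Thm. 1.2, Prop. 6.14 and Main Conj. 7.21]
[cite: Sprung2024, §5.2 Lemmas 5.5–5.9] [cite: BirchSwinnertonDyer1965] -/
theorem sprungLowerHalfAtThree_of_lowerDivisibility_analyticRank_eq_zero
    (hK1z : ∀ (W : WeierstrassCurve ℚ) [W.IsElliptic] [W.IsGloballyMinimal] (p : ℕ) [Fact p.Prime],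
      ClassX8 W p → W.analyticRank = 0 → ∀ col : Chroma, SprungSharpFlatLowerDivisibility W p col)
    (hK2 : SharpFlatRankZeroConverseAtThree) (hK3 : SharpFlatCharValueRankZeroAllLevels)
    (hS4 : SharpFlatPublishedInputsAtThree) : SprungLowerHalfAtThree := by
  intro W _ _ p _ hX
  have hp3 : p = 3 := hX.1
  subst hp3
  have hp2 : (3 : ℕ) ≠ 2 := by decide
  have hgood : W.HasGoodReductionAtPrime 3 := hX.2.1.1
  have hdvd : ((3 : ℕ) : ℤ) ∣ W.frobeniusTrace 3 := hX.2.1.2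
  -- S4(M): a newform `f` of `W`; stub (A): the real objects `(f, ϖ, L♯, L♭)` — the period ratio by the
  -- tree theorems behind `exists_pos_periodRatio_of_isNewformOf` (Néron lattice, Manin constant, Edixhoven's
  -- relation; p453712) and a Sprung pair by `thm112_exists_isSprungPair_holds` (Sprung 2017 Thm. 1.12)
  obtain ⟨⟨N, hN, f, hf⟩, hS4'⟩ := hS4 W 3 hX
  haveI := hN
  haveI : (W.baseChange ℂ).IsElliptic := by rw [WeierstrassCurve.baseChange]; infer_instance
  obtain ⟨Lat, hLat⟩ := exists_isNeronLatticeOf_holds (W.baseChange ℂ)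
  obtain ⟨cM, hcM0, hcM⟩ := IsNewformOf.exists_maninConstant_ne_zero_holds hf hLat
  obtain ⟨Dm, hDf, -, -⟩ := ModularParametrizationData.exists_of_isNewformOf hf hLat hcM0 hcM
  obtain ⟨ϖ, -, hϖ', -⟩ := Dm.exists_rat_mul_realPeriodRat_eq_plusPeriod
  have hϖ : (ϖ : ℝ) * W.realPeriodRat = plusPeriod f := by rw [hϖ', hDf]
  obtain ⟨Lsharp, Lflat, hSP⟩ :=
    thm112_exists_isSprungPair_holds (W := W) (f := f) (p := 3) hp2 hf hgood hdvd
  suffices hB : ∃ (col : Chroma) (ξ : IwasawaAlgebra 3),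
      (⟨ξ, 0, 0⟩ : SignedDatum W 3).EulerCharacteristic ∧
        ∃ h : IwasawaAlgebra 3, iwasawaToPowerSeries 3 ξ =
          PowerSeries.C (ϖ : ℚ_[3]) * iwasawaToPowerSeries 3 (chromaticL col Lsharp Lflat * h) by
    obtain ⟨col, ξ, hK, hdiv⟩ := hB
    exact ⟨N, hN, f, ϖ, Lsharp, Lflat, col, ξ, hf, hϖ, hSP, hK, hdiv⟩
  -- positive corank: `ξ = h = 0` — K1 is not used
  by_cases hfin : Finite (W.selmerGroupPInfty 3)
  swap
  · exact ⟨.flat, chromaticDatum_of_not_finite_selmer W 3 hfin ϖ (chromaticL .flat Lsharp Lflat)⟩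
  -- corank zero: (conv₀) gives `L(E,1) ≠ 0`, i.e. `r_an = 0`
  have hL : W.entireLFunction 1 ≠ 0 := hK2 W 3 hX hfin
  have h0 : W.analyticRank = 0 :=
    Literature.NumberTheory.EllipticCurves.analyticRank_eq_zero_of_entireLFunction_one_ne_zero W hL
  obtain ⟨κ, hκ, γ, hγ, hγ'⟩ := exists_isCyclotomic_isTopGenerator_isCyclotomicVariable_holds 3
  obtain ⟨v, hv⟩ :=
    Literature.NumberTheory.NumberFields.RingOfIntegers.exists_heightOneSpectrum_natCast_mem ℚ
      (p := 3) (by norm_num)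
  obtain ⟨g, hg⟩ := hκ.exists_isTopGenerator_resGalOfEmb_adicCompletion v hv
  obtain ⟨⟨cneg, c, hc⟩, h714⟩ := hS4' κ γ hκ hγ hγ' v hv g hg
  -- a colour with `L^• ≠ 0` (Sprung 2012 Prop. 6.14, tree theorem)
  obtain ⟨col, hcol⟩ := hSP.exists_chromaticL_ne_zero hf hgood
  -- Sprung's real `X^•(E/ℚ_∞)` (p470048)
  let D := sharpFlatSelmerDualData W κ (closureEmb (K := ℚ) (v.adicCompletion ℚ))
    (W.frobeniusTrace 3) g c col hγ
  -- K1 AT THIS RANK-ZERO PAIR ONLY: a generator of `char_Λ(X^•)` divisible by `ϖ · L^•`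
  obtain ⟨gen, h, hchar, hι⟩ :=
    hK1z W 3 hX h0 col κ γ hκ hγ hγ' v hv g hg cneg c hc N hN f ϖ Lsharp Lflat hf hϖ hSP hcol D
  -- cotorsion (S4(T)) and (K•) at all levels (K3)
  haveI := hN
  obtain ⟨hfinD, htorD⟩ := h714 cneg c hc N hN f hf col Lsharp Lflat hSP hcol D
  haveI := hfinD
  obtain ⟨u, hu⟩ :=
    hK3 W 3 hp2 hgood hdvd hL κ γ hκ hγ hγ' v hv g hg cneg c hc col D htorD gen hchar hfin
  exact ⟨col, gen, fun _ => ⟨u, hu⟩, h, hι⟩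

section RankCut


-- The registered v7 stub K_spor VERBATIM (as in p614828) and the positive-level part of S4b VERBATIM (the hypothesis `hCyc` of
-- the lead's split door p617801), as section hypotheses.
variable
  (hKsp :
    ∀ (W : WeierstrassCurve ℚ) [W.IsElliptic] [W.IsGloballyMinimal] (p : ℕ) [Fact p.Prime]
      [ContinuousSMul ℤ_[p] (W.tateModule p)] [Module.Free ℤ_[p] (W.tateModule p)]
      [Module.Finite ℤ_[p] (W.tateModule p)],
      ClassX8 W p → ∀ (κ : ZpExtension ℚ p) (γ : Field.absoluteGaloisGroup ℚ),
      κ.IsCyclotomic → κ.IsTopGenerator γ → IsCyclotomicVariable p γ →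
    ∀ (v : HeightOneSpectrum (𝓞 ℚ)), (p : 𝓞 ℚ) ∈ v.asIdeal →
    ∀ (g : Field.absoluteGaloisGroup (v.adicCompletion ℚ)),
      κ.IsTopGenerator (resGalOfEmb (closureEmb (K := ℚ) (v.adicCompletion ℚ)) g) →
    ∀ (cneg : localPoints W (v.adicCompletion ℚ)) (c : ℕ → localPoints W (v.adicCompletion ℚ)),
      IsHondaSystem κ (closureEmb (K := ℚ) (v.adicCompletion ℚ)) W (W.frobeniusTrace p) g cneg c →
    ∀ (N : ℕ) (_ : NeZero N) (f : CuspForm (Gamma0 N) 2) (ϖ : ℚ) (Lsharp Lflat : IwasawaAlgebra p),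
      IsNewformOf W f → (ϖ : ℝ) * W.realPeriodRat = plusPeriod f →
      IsSprungPair f p (W.frobeniusTrace p) Lsharp Lflat →
    ∀ (I : Kato2004.IwasawaH1Data W p κ γ)
      (Cs : SharpFlatColemanKatoData W p f ϖ κ γ (closureEmb (K := ℚ) (v.adicCompletion ℚ))
        (W.frobeniusTrace p) g c Chroma.sharp I)
      (Cf : SharpFlatColemanKatoData W p f ϖ κ γ (closureEmb (K := ℚ) (v.adicCompletion ℚ))
        (W.frobeniusTrace p) g c Chroma.flat I),
      Cs.Z = Cf.Z →
    ∀ (Y : W.FineSelmerDualData κ γ) (𝔭 : PrimeSpectrum (IwasawaAlgebra p)), 𝔭.asIdeal.height = 1 →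
      (p : IwasawaAlgebra p) ∉ 𝔭.asIdeal →
      (¬ ∃ n : ℕ, ((cyclotomicOmega p n).map (Int.castRingHom ℤ_[p]) : PowerSeries ℤ_[p]) ∈ 𝔭.asIdeal) →
      (∀ (col' : Chroma) (G' : IwasawaAlgebra p),
        iwasawaToPowerSeries p G' =
          PowerSeries.C (ϖ : ℚ_[p]) * iwasawaToPowerSeries p (chromaticL col' Lsharp Lflat) →
        G' ∈ 𝔭.asIdeal) →
      Module.lengthAt (IwasawaAlgebra p) (I.H ⧸ Cs.Z) 𝔭 ≤ Module.lengthAt (IwasawaAlgebra p) Y.X 𝔭)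
  (hCyc :
    ∀ (W : WeierstrassCurve ℚ) [W.IsElliptic] [W.IsGloballyMinimal] (p : ℕ) [Fact p.Prime]
      [ContinuousSMul ℤ_[p] (W.tateModule p)] [Module.Free ℤ_[p] (W.tateModule p)]
      [Module.Finite ℤ_[p] (W.tateModule p)],
      ClassX8 W p → ∀ (col : Chroma) (κ : ZpExtension ℚ p) (γ : Field.absoluteGaloisGroup ℚ),
      κ.IsCyclotomic → κ.IsTopGenerator γ → IsCyclotomicVariable p γ →
    ∀ (v : HeightOneSpectrum (𝓞 ℚ)), (p : 𝓞 ℚ) ∈ v.asIdeal →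
    ∀ (g : Field.absoluteGaloisGroup (v.adicCompletion ℚ)),
      κ.IsTopGenerator (resGalOfEmb (closureEmb (K := ℚ) (v.adicCompletion ℚ)) g) →
    ∀ (cneg : localPoints W (v.adicCompletion ℚ)) (c : ℕ → localPoints W (v.adicCompletion ℚ)),
      IsHondaSystem κ (closureEmb (K := ℚ) (v.adicCompletion ℚ)) W (W.frobeniusTrace p) g cneg c →
    ∀ (N : ℕ) (_ : NeZero N) (f : CuspForm (Gamma0 N) 2) (ϖ : ℚ) (Lsharp Lflat : IwasawaAlgebra p),
      IsNewformOf W f → (ϖ : ℝ) * W.realPeriodRat = plusPeriod f →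
      IsSprungPair f p (W.frobeniusTrace p) Lsharp Lflat → chromaticL col Lsharp Lflat ≠ 0 →
    ∀ (D : SharpFlatSelmerDualData W κ γ (closureEmb (K := ℚ) (v.adicCompletion ℚ))
        (W.frobeniusTrace p) g c col) [Module.Finite (IwasawaAlgebra p) D.X],
      Module.IsTorsion (IwasawaAlgebra p) D.X →
    ∀ (G : IwasawaAlgebra p),
      iwasawaToPowerSeries p G =
        PowerSeries.C (ϖ : ℚ_[p]) * iwasawaToPowerSeries p (chromaticL col Lsharp Lflat) →
    ∀ (I : Kato2004.IwasawaH1Data W p κ γ)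
      (Cs : SharpFlatColemanKatoData W p f ϖ κ γ (closureEmb (K := ℚ) (v.adicCompletion ℚ))
        (W.frobeniusTrace p) g c Chroma.sharp I)
      (Cf : SharpFlatColemanKatoData W p f ϖ κ γ (closureEmb (K := ℚ) (v.adicCompletion ℚ))
        (W.frobeniusTrace p) g c Chroma.flat I),
      Cs.Z = Cf.Z →
    ∀ 𝔭 : PrimeSpectrum (IwasawaAlgebra p), 𝔭.asIdeal.height = 1 →
      (PowerSeries.X : IwasawaAlgebra p) ∉ 𝔭.asIdeal →
      (∃ j : ℕ, 1 ≤ j ∧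
        ((((Polynomial.cyclotomic (p ^ j) ℤ).comp (Polynomial.X + 1)).map (Int.castRingHom ℤ_[p]) : Polynomial ℤ_[p]) :
          PowerSeries ℤ_[p]) ∈ 𝔭.asIdeal) →
      (∀ (col' : Chroma) (G' : IwasawaAlgebra p),
        iwasawaToPowerSeries p G' =
          PowerSeries.C (ϖ : ℚ_[p]) * iwasawaToPowerSeries p (chromaticL col' Lsharp Lflat) →
        G' ∈ 𝔭.asIdeal) →
      Module.lengthAt (IwasawaAlgebra p) (IwasawaAlgebra p ⧸ Ideal.span {G}) 𝔭 ≤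
        Module.lengthAt (IwasawaAlgebra p) D.X 𝔭)

/-! ### §2 The composition for route `SignedLowerHalves` -/

section
include hKsp hCyc

/-- **Crux 5 `SprungLowerHalfAtThree` BY NAME from `hKsp ∧ hCyc ∧ h714 ∧ h3 ∧ hJ ∧ K2 ∧ K3 ∧ S4`** — compare the status quo
`crux 5 ⟸ K1 ∧ K2 ∧ K3 ∧ S4` (glue 19880), `K1 ⟸ hKsp ∧ S4b ∧ (h714 ∧ h3 ∧ hJ ∧ hGZK ∧ hKob)` (p614828),
`S4b ⟸ hCyc ∧ hMinOrd` (p617801): the rank cut removes `hMinOrd` (the signed `3`-adic BSD rank inequality at `r_an ≥ 2`), `hGZK`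
and `hKob` from crux 5's cone. What remains OPEN for route K3 behind item 19875 is exactly «Kato 2004 Conj. 12.10 (Eisenstein half)
at the sporadic common zeros» ∧ «Sprung 2012 Main Conj. 7.21 at the positive-level cyclotomic common zeros», at the X8 pairs of
analytic rank `0`. CONDITIONAL (displayed); closes nothing; calibration only (pen R-RANKCUT).
[cite: Kato2004Asterisque, Conj. 12.10 (p. 224)] [cite: Sprung2012, Main Conj. 7.21 (p. 1505), Thm. 7.14 (p. 1504)] [cite: Sprung2024, §5.2 Lemmas 5.5–5.9] -/
theorem sprungLowerHalfAtThree_of_katoSporadic_of_posLevel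
    (h714 : thm714_sharpFlatSelmerDual_finite_torsion) (h3 : realPeriodRat_eq_unit_mul_plusPeriod_three)
    (hJ : thm714seq_sharpFlatColemanKato_zetaJoint)
    (hK2 : SharpFlatRankZeroConverseAtThree) (hK3 : SharpFlatCharValueRankZeroAllLevels)
    (hS4 : SharpFlatPublishedInputsAtThree) : SprungLowerHalfAtThree :=
  sprungLowerHalfAtThree_of_lowerDivisibility_analyticRank_eq_zero
    (lowerDivisibility_analyticRank_eq_zero_of_katoSporadic_of_posLevel hKsp hCyc h714 h3 hJ) hK2 hK3 hS4

end

end RankCut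

end Summit.BirchSwinnertonDyer.BirchSwinnertonDyer.Theorems.ChromaticCommonZeros

end
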